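import Literature.NumberTheory.LFunctions.ExplicitFormulaPsiOne
import Literature.Analysis.SpecialFunctions.DigammaReflection

/-!
# PF persistence, fake seat 1 — F1-S (a): the real part of `ζ'/ζ` on the critical line

Unit `pub-rhpf-fake-1` of the `pub-rhpf` cell (mechanism / rigidity campaign; **no RH claims**).
`HOME/FAKES.md §1.8.1` THEOREM F1-S (a) is the identity used to cancel the `s = 1` point in the
Landau-lemma arguments of THEOREM F1-T₁ / F1-T₂ (§1.8.3′/§1.8.3″) and to evaluate the template line
density at `t = 0`:

  `Re ζ'/ζ(1/2 + it) = (log π)/2 − Re ψ(1/4 + it/2)/2`   whenever `ζ(1/2 + it) ≠ 0`,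

i.e. `A(t) := Re ψ(1/4 + it/2) − log π = −2 Re ζ'/ζ(1/2 + it)`.  Proof: `ζ'/ζ = ξ'/ξ − 1/s − 1/(s−1) −
Γ_ℝ'/Γ_ℝ` (tree: `PsiOneExplicit.logDeriv_riemannZeta_eq_logDeriv_riemannXi`), `Re ξ'/ξ(1/2+it) = 0`
from `ξ(1−s) = ξ(s)` and Schwarz reflection (tree: `logDeriv_riemannXi_one_sub`,
`logDeriv_riemannXi_conj`; also landed as `SignConeConeMagnification.re_logDeriv_riemannXi_half_add`), `Re(1/s + 1/(s−1)) = 0` on the line, and `Γ_ℝ'/Γ_ℝ(s) = −½ log π + ½ ψ(s/2)`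
(tree: `logDeriv_Gammaℝ`).  At `t = 0`, with Gauss's `ψ(1/4) = −γ − π/2 − 3 log 2`
(tree: `digamma_one_quarter_eq_neg_ofReal`): `ζ'/ζ(1/2) = (log π + γ + π/2 + 3 log 2)/2 (= 2.68609…)`.
Everything here is unconditional and about `ζ` only through cited tree lemmas; nothing about RH.
-/

set_option linter.dupNamespace false

noncomputable section

open Complex

namespace Summit.RiemannHypothesis.RiemannHypothesis.Theorems.PfPersistence.Fake1.CriticalLine

open Literature.NumberTheory.LFunctions
open Literature.Analysis.SpecialFunctions.Complex

/-- `Re (1/s + 1/(s − 1)) = 0` for `s = 1/2 + it`. [folklore] -/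
theorem re_inv_add_inv_sub_one_half (t : ℝ) :
    (1 / (1 / 2 + t * I : ℂ)).re + (1 / ((1 / 2 + t * I : ℂ) - 1)).re = 0 := by
  have h1 : (1 / 2 + t * I : ℂ) - 1 = -(1 / 2) + t * I := by ring
  rw [h1]
  simp only [one_div, Complex.inv_re, Complex.normSq_apply, Complex.add_re, Complex.mul_re,
    Complex.I_re, Complex.I_im, Complex.ofReal_re, Complex.ofReal_im, Complex.add_im,
    Complex.mul_im, Complex.neg_re, Complex.neg_im, Complex.inv_im]
  norm_num
  ring

/-- **F1-S (a)**: `Re ζ'/ζ(1/2 + it) = (log π)/2 − Re ψ(1/4 + it/2)/2` whenever `ζ(1/2 + it) ≠ 0`.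
[folklore] -/
theorem re_logDeriv_riemannZeta_half {t : ℝ} (hζ : riemannZeta (1 / 2 + t * I) ≠ 0) :
    (deriv riemannZeta (1 / 2 + t * I) / riemannZeta (1 / 2 + t * I)).re =
      Real.log Real.pi / 2 - (Complex.digamma (1 / 4 + t / 2 * I)).re / 2 := by
  set s : ℂ := 1 / 2 + t * I with hs
  have hre : s.re = 1 / 2 := by simp [hs]
  have h0 : s ≠ 0 := fun h => by
    have := congrArg Complex.re h
    rw [hre] at this
    norm_num at this
  have h1 : s ≠ 1 := fun h => by
    have := congrArg Complex.re h
    rw [hre] at this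
    norm_num at this
  have hpole : ∀ m : ℕ, s / 2 ≠ -m := by
    intro m h
    have := congrArg Complex.re h
    simp [hs] at this
    have hm : (0 : ℝ) ≤ m := Nat.cast_nonneg m
    linarith
  rw [PsiOneExplicit.logDeriv_riemannZeta_eq_logDeriv_riemannXi (by rw [hre]; norm_num) h0 h1 hζ,
    logDeriv_Gammaℝ hpole]
  have hs2 : s / 2 = 1 / 4 + t / 2 * I := by
    rw [hs]; ring
  rw [hs2, ← Complex.ofReal_log Real.pi_pos.le]
  -- `Re ξ'/ξ(s) = 0` (also landed as `SignConeConeMagnification.re_logDeriv_riemannXi_half[_add]`;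
  -- re-derived inline from `logDeriv_riemannXi_one_sub` / `logDeriv_riemannXi_conj` to keep imports light)
  have hξ : (logDeriv riemannXi s).re = 0 := by
    have h1s : 1 - s = (starRingEnd ℂ) s := by
      apply Complex.ext
      · simp [hs]; norm_num
      · simp [hs]
    have h := logDeriv_riemannXi_one_sub s
    rw [h1s, logDeriv_riemannXi_conj] at h
    have hre' := congrArg Complex.re h
    simp only [Complex.conj_re, Complex.neg_re] at hre'
    linarith
  have hq : (1 / s).re + (1 / (s - 1)).re = 0 := re_inv_add_inv_sub_one_half t
  simp only [Complex.sub_re, Complex.add_re, Complex.neg_re, Complex.div_ofNat_re,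
    Complex.ofReal_re, neg_div] at hξ hq ⊢
  linarith

/-- The campaign's archimedean weight `A(t) = Re ψ(1/4 + it/2) − log π` equals `−2 Re ζ'/ζ(1/2+it)`
off the ordinates (FAKES §1.8.1 F1-S (a), the form used in §1.8.3′/§1.8.3″). [folklore] -/
theorem archWeight_eq_neg_two_mul_re_logDeriv {t : ℝ} (hζ : riemannZeta (1 / 2 + t * I) ≠ 0) :
    (Complex.digamma (1 / 4 + t / 2 * I)).re - Real.log Real.pi =
      -2 * (deriv riemannZeta (1 / 2 + t * I) / riemannZeta (1 / 2 + t * I)).re := by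
  rw [re_logDeriv_riemannZeta_half hζ]; ring

/-- **The value at the real point**: `ζ'/ζ(1/2) = (log π + γ + π/2 + 3 log 2)/2` (`= 2.686…`), from
F1-S (a) at `t = 0` and Gauss's `ψ(1/4) = −γ − π/2 − 3 log 2`; in particular it is real and the
campaign's `ψ(1/4) − log π = −2 ζ'/ζ(1/2)`. [folklore] -/
theorem re_logDeriv_riemannZeta_one_half :
    (deriv riemannZeta (1 / 2) / riemannZeta (1 / 2)).re =
      (Real.log Real.pi + Real.eulerMascheroniConstant + Real.pi / 2 + 3 * Real.log 2) / 2 := by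
  -- `ζ(1/2) ≠ 0` (landed as `Literature.NumberTheory.LFunctions.riemannZeta_one_half_ne_zero`; inline here
  -- from `riemannZeta_neg_of_pos_of_lt_one` to keep imports light)
  have hζ : riemannZeta (1 / 2) ≠ 0 := by
    have h := riemannZeta_neg_of_pos_of_lt_one (σ := 1 / 2) (by norm_num) (by norm_num)
    have h' : ((1 / 2 : ℝ) : ℂ) = 1 / 2 := by push_cast; ring
    rw [h'] at h
    intro h0
    rw [h0] at h
    simp at h
  have h := re_logDeriv_riemannZeta_half (t := 0) (by simpa using hζ)
  simp only [Complex.ofReal_zero, zero_mul, add_zero, zero_div] at h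
  rw [h, digamma_one_quarter_eq_neg_ofReal]
  simp only [Complex.neg_re, Complex.ofReal_re]
  ring

end Summit.RiemannHypothesis.RiemannHypothesis.Theorems.PfPersistence.Fake1.CriticalLine
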